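import Mathlib
import HarnessLib
import Literature.NumberTheory.GaloisRepresentations.EnormousSubgroup
import Literature.NumberTheory.GaloisRepresentations.ProjectiveTypeSolvable
import Summits.Langlands.Langlands.Theorems.NonParallelVoidTensorSquareParallelStubEnormousResidualPackageEnormousOfDihedral
import Summits.Langlands.Langlands.Theorems.NonParallelVoidLocallyReducibleParallelStubQianPackageOfPrimeToPMatrices

/-!
# Stub `stub_qianPackage_of_primeToP` of line `potaut` for crux `LocallyReducibleParallel`
# (stmt-Langlands-17002) — helper 1b: an absolutely irreducible subgroup of `GL₂(k)` of finite
# order prime to `p = char k ≠ 2` is enormous (ACC+ Def. 6.2.28)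

Crux `stmt-Langlands-17002` = `Summit.Langlands.Langlands.Theses.NonParallelVoid.LocallyReducibleParallel`
(line `potaut`, stub `stub_qianPackage_of_primeToP`: hypotheses (iii)–(iv) of Qian 2023 Thm. 1.4
for `ρ̄|_{Γ_{F(ζ_p)}}` absolutely irreducible with projective image of order prime to `p`).  The
sibling crux `TensorSquareParallel` landed the "enormous image" conjunct in the projectively
DIHEDRAL corner (`isEnormous_range_of_isDihedralType`); this file PROVES it (no named fact)
uniformly for EVERY prime-to-`p` absolutely irreducible image — so also for the primitive types
`𝔄₄`, `𝔖₄`, `𝔄₅` of Serre 1972 Prop. 16 —, as pure group theory: for `k` algebraically closed of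
characteristic `p ≠ 2` whose units have finite order prime to `p` (e.g. `k = 𝔽̄_p`), an absolutely
irreducible `r : G → GL₂(k)` with finite image `H` of order prime to `p` has ENORMOUS image (tree
`Subgroup.IsEnormous`: (1) no `p`-power quotient, (2) `(ad⁰)^H = 0 = H¹(H, ad⁰)`, (3) every simple
`k[H]`-submodule `W ≤ ad⁰` has a non-zero vector fixed by a regular semisimple element of `H`).

Normal form (matrix lemmas in `…StubQianPackageOfPrimeToPMatrices`): a non-central `r(g₁)` (no
common eigenvector) of order prime to `p` is conjugate to `D = diag(a, b)`, `a ≠ b`, and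
enormousness only depends on the image in `PGL₂` up to conjugation (tree
`isEnormous_of_forall_exists_eq_scalar_mul_conj`); every non-central element of `H` is regular
semisimple.  (1), (2b): `|H| ∈ kˣ` and coset averaging, as in the sibling's
`isEnormous_range_of_monomial`; (2a): an invariant `M ∈ ad⁰` commutes with `D`, so
`M = diag(m, -m)`, and `m ≠ 0` would make `H` diagonal; (3):
`exists_isRegularSemisimple_of_normalForm` (its docstring has the case analysis).

* §2 `exists_isRegularSemisimple_of_normalForm`; §3 `isEnormous_range_of_normalForm`,
  `isEnormous_range_of_not_dvd_card`.

## References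

* [ACCGHLNSTT2023] P. B. Allen et al., *Potential automorphy over CM fields*, Ann. of Math. 197
  (2023) = arXiv:1812.09999, Def. 6.2.28 and the remark following it.
* [GuralnickHerzigTiep2017] R. Guralnick, F. Herzig, P. H. Tiep, *Adequate subgroups and
  indecomposable modules*, JEMS 19 (2017), §1 (prime-to-`p` groups are adequate: the averaging).
* [Qian2022] L. Qian, *Potential automorphy for `GL_n`*, Invent. Math. 231 (2023), Thm. 1.4 (iii).
-/


set_option linter.dupNamespace false

noncomputable section

namespace Summit.Langlands.Langlands.Cruxes.LocallyReducibleParallel.Potaut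

open scoped MatrixGroups Polynomial
open Matrix Literature.NumberTheory.GaloisRepresentations
open Summit.Langlands.Langlands.Cruxes.AdjointLiftingGL3.Birth
open Summit.Langlands.Langlands.Theorems.TensorSquareParallel

universe u v

/-! ## §2. Clause (3) in normal form -/
section Clause3

variable {k : Type u} [Field k] [IsAlgClosed k] {p : ℕ} [Fact p.Prime] [CharP k p]
variable {G : Type v} [Group G]


/-- **Clause (3) of "enormous" in normal form.**  Let `r : G → GL₂(k)` (`k` algebraically closed,
`char k = p ≠ 2`) have finite image `H` of order prime to `p`, no common eigenvector, and some
`r(h₀) = D = diag(a, b)` with `a ≠ b`.  Then every simple `k[H]`-submodule `W ≤ ad⁰` contains a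
non-zero vector fixed by a regular semisimple element of `H`.  Cases: if some `w ∈ W` has non-zero
diagonal part, the sibling's combination `ab·Ad_D² w - (a²+b²)·Ad_D w + ab·w ≠ 0` is diagonal, in
`W`, fixed by `D`; otherwise `W ⊆ ⟨E₀₁, E₁₀⟩`.  If `E₀₁, E₁₀ ∈ W` then `Ad(g)E₀₁`, `Ad(g)E₁₀` have
zero diagonal for all `g ∈ H`, forcing `g` diagonal or antidiagonal: `H` is monomial and
`E₀₁ + Ad_A E₀₁ ≠ 0` is fixed by an antidiagonal (regular semisimple) `A ∈ H`.  Otherwise, with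
`0 ≠ w = x E₀₁ + y E₁₀ ∈ W`: when `a² ≠ b²` the `Ad(D)`-eigenvalues `a/b ≠ b/a` split `w`, so
`E₀₁` or `E₁₀` alone lies in `W`, an `H`-stable line making `H` triangular — a common eigenvector;
when `b = -a` (`Ad(D) w = -w`): `x = 0` or `y = 0` is triangular again, and for `xy ≠ 0` the space
`W` is the line `k w`, `Ad(g) w = ± w` for `g ∈ H` (determinants), and if every `g ∈ H` fixing `w`
were central then every `g` with `Ad(g) w = -w` would have `gD` central — `H` diagonal, a common
eigenvector; so some non-central (regular semisimple) `g ∈ H` fixes `w`.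
[cite: ACCGHLNSTT2023, Def. 6.2.28 (3)] -/
theorem exists_isRegularSemisimple_of_normalForm (hp2 : p ≠ 2) (r : G →* GL (Fin 2) k)
    [Finite r.range] (hcard : ¬ p ∣ Nat.card r.range) (hce : ¬ HasCommonEigenvector r)
    {h₀ : G} (hD : GL2.IsDg ((r h₀ : GL (Fin 2) k) : Matrix (Fin 2) (Fin 2) k))
    (hab : ((r h₀ : GL (Fin 2) k) : Matrix (Fin 2) (Fin 2) k) 0 0 ≠ ((r h₀ : GL (Fin 2) k) : Matrix (Fin 2) (Fin 2) k) 1 1)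
    (W : Subrepresentation (Subgroup.adZeroRep r.range)) (hW : IsAtom W) :
    ∃ h : r.range, IsRegularSemisimple (h : GL (Fin 2) k) ∧
      ∃ w ∈ W, w ≠ 0 ∧ Subgroup.adZeroRep r.range h w = w := by
  classical
  have hp : p.Prime := Fact.out
  have htwo : (2 : k) ≠ 0 := fun h ↦ by
    have h' : ((2 : ℕ) : k) = 0 := by exact_mod_cast h
    exact hp2 ((Nat.prime_dvd_prime_iff_eq hp Nat.prime_two).1 ((CharP.cast_eq_zero_iff k p _).1 h'))
  set D : GL (Fin 2) k := r h₀ with hDdef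
  obtain ⟨ha, hb⟩ := GL2.IsDg.entry_ne_zero hD (GL2.det_ne_zero D)
  have hDH : D ∈ r.range := ⟨h₀, rfl⟩
  have hrs : ∀ {g : GL (Fin 2) k}, g ∈ r.range → g ∉ Subgroup.center (GL (Fin 2) k) →
      IsRegularSemisimple g := fun hg hgc ↦ isRegularSemisimple_of_mem_of_not_mem_center hcard hg hgc
  have hstab : ∀ {z : GL (Fin 2) k}, z ∈ r.range → ∀ {v : (adZero (Fin 2) k).toSubmodule},
      v ∈ W.toSubmodule → (adZero (Fin 2) k).toRepresentation z v ∈ W.toSubmodule :=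
    fun hz v hv ↦ W.apply_mem_toSubmodule ⟨_, hz⟩ hv
  have hWne : W.toSubmodule ≠ ⊥ := fun h ↦ hW.1 (Subrepresentation.toSubmodule_injective h)
  by_cases hA : ∃ w ∈ W.toSubmodule, (w : Matrix (Fin 2) (Fin 2) k) 0 0 ≠ 0
  · -- Case A: the diagonal part of some `w ∈ W` is non-zero — use `D`
    obtain ⟨w, hwW, h00⟩ := hA
    set N : (adZero (Fin 2) k).toSubmodule :=
      ((D : Matrix (Fin 2) (Fin 2) k) 0 0 * (D : Matrix (Fin 2) (Fin 2) k) 1 1) • (adZero (Fin 2) k).toRepresentation D ((adZero (Fin 2) k).toRepresentation D w) -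
        ((D : Matrix (Fin 2) (Fin 2) k) 0 0 ^ 2 + (D : Matrix (Fin 2) (Fin 2) k) 1 1 ^ 2) • (adZero (Fin 2) k).toRepresentation D w +
        ((D : Matrix (Fin 2) (Fin 2) k) 0 0 * (D : Matrix (Fin 2) (Fin 2) k) 1 1) • w with hNdef
    have hNval : (N : Matrix (Fin 2) (Fin 2) k) = !![-((D : Matrix (Fin 2) (Fin 2) k) 0 0 - (D : Matrix (Fin 2) (Fin 2) k) 1 1) ^ 2 * (w : Matrix (Fin 2) (Fin 2) k) 0 0, 0;
        0, -((D : Matrix (Fin 2) (Fin 2) k) 0 0 - (D : Matrix (Fin 2) (Fin 2) k) 1 1) ^ 2 * (w : Matrix (Fin 2) (Fin 2) k) 1 1] := by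
      simp only [hNdef, Submodule.coe_add, Submodule.coe_sub, Submodule.coe_smul, coe_adGL_apply]
      exact combination_conj_of_isDg D hD (w : Matrix (Fin 2) (Fin 2) k)
    have hNW : N ∈ W.toSubmodule :=
      W.toSubmodule.add_mem (W.toSubmodule.sub_mem
        (W.toSubmodule.smul_mem _ (hstab hDH (hstab hDH hwW)))
        (W.toSubmodule.smul_mem _ (hstab hDH hwW))) (W.toSubmodule.smul_mem _ hwW)
    refine ⟨⟨D, hDH⟩, isRegularSemisimple_of_isDg D hD hab, N, hNW, fun h0 ↦ ?_, ?_⟩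
    · have e : (N : Matrix (Fin 2) (Fin 2) k) 0 0 = 0 := by rw [h0, ZeroMemClass.coe_zero, Matrix.zero_apply]
      rw [hNval] at e
      change -((D : Matrix (Fin 2) (Fin 2) k) 0 0 - (D : Matrix (Fin 2) (Fin 2) k) 1 1) ^ 2 * (w : Matrix (Fin 2) (Fin 2) k) 0 0 = 0 at e
      rcases mul_eq_zero.1 e with e | e
      · exact hab (sub_eq_zero.1 (pow_eq_zero_iff two_ne_zero |>.1 (neg_eq_zero.1 e)))
      · exact h00 e
    · refine Subtype.ext ?_
      change (D : Matrix (Fin 2) (Fin 2) k) * (N : Matrix (Fin 2) (Fin 2) k) * ((D⁻¹ : GL (Fin 2) k) : Matrix (Fin 2) (Fin 2) k) = N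
      rw [conj_of_isDg D hD, hNval]
      ext i j; fin_cases i <;> fin_cases j <;> simp
  · -- Case B: every element of `W` has zero diagonal
    push Not at hA
    obtain ⟨E01, E10, hE, hF⟩ := exists_E01_E10 (k := k)
    by_cases hB1 : E01 ∈ W.toSubmodule ∧ E10 ∈ W.toSubmodule
    · -- `E₀₁, E₁₀ ∈ W`: `H` is monomial; use an antidiagonal element
      obtain ⟨hE01, hE10⟩ := hB1
      have hmono : ∀ g ∈ r.range, GL2.IsDg (g : Matrix (Fin 2) (Fin 2) k) ∨ GL2.IsAd (g : Matrix (Fin 2) (Fin 2) k) := fun g hg ↦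
        isDg_or_isAd_of_adGL hE hF g (hA _ (hstab hg hE01)) (hA _ (hstab hg hE10))
      obtain ⟨g₀, hg₀⟩ : ∃ g₀, ¬ GL2.IsDg ((r g₀ : GL (Fin 2) k) : Matrix (Fin 2) (Fin 2) k) := by
        by_contra! hall
        exact hce (hasCommonEigenvector_of_forall_isDg hall)
      set A : GL (Fin 2) k := r g₀ with hAdef
      have hAH : A ∈ r.range := ⟨g₀, rfl⟩
      have hAad : GL2.IsAd (A : Matrix (Fin 2) (Fin 2) k) := (hmono A hAH).resolve_left hg₀
      obtain ⟨hx, hy⟩ := GL2.IsAd.entry_ne_zero hAad (GL2.det_ne_zero A)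
      refine ⟨⟨A, hAH⟩, isRegularSemisimple_of_isAd htwo A hAad, E01 + (adZero (Fin 2) k).toRepresentation A E01,
        W.toSubmodule.add_mem hE01 (hstab hAH hE01), fun h0 ↦ ?_,
        adGL_apply_add_adGL_apply A hAad E01⟩
      have e := coe_add_adGL_apply_zero_one A hAad E01
      rw [h0, ZeroMemClass.coe_zero, Matrix.zero_apply, hE] at e
      simp [hy] at e
    · -- not both `E₀₁`, `E₁₀` lie in `W`
      have hupper : E01 ∈ W.toSubmodule → E10 ∉ W.toSubmodule → False := by
        intro hE01 hE10
        refine hce (hasCommonEigenvector_of_apply_one_zero_eq_zero fun g ↦ ?_)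
        have hg : r g ∈ r.range := ⟨g, rfl⟩
        obtain ⟨x, y, hw'⟩ : ∃ x y : k, (adZero (Fin 2) k).toRepresentation (r g) E01 = x • E01 + y • E10 :=
          ⟨_, _, eq_add_of_apply_zero_zero hE hF _ (hA _ (hstab hg hE01))⟩
        have hy : y = 0 := by
          by_contra hy
          apply hE10
          have hmem : (adZero (Fin 2) k).toRepresentation (r g) E01 - x • E01 ∈ W.toSubmodule :=
            W.toSubmodule.sub_mem (hstab hg hE01) (W.toSubmodule.smul_mem _ hE01)
          rw [hw', add_sub_cancel_left] at hmem
          exact (Submodule.smul_mem_iff _ hy).1 hmem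
        rw [hy, zero_smul, add_zero] at hw'
        exact apply_one_zero_eq_zero_of_adGL_E01 hE hw'
      have hlower : E10 ∈ W.toSubmodule → E01 ∉ W.toSubmodule → False := by
        intro hE10 hE01
        refine hce (hasCommonEigenvector_of_forall_apply_zero_one fun g ↦ ?_)
        have hg : r g ∈ r.range := ⟨g, rfl⟩
        obtain ⟨x, y, hw'⟩ : ∃ x y : k, (adZero (Fin 2) k).toRepresentation (r g) E10 = x • E01 + y • E10 :=
          ⟨_, _, eq_add_of_apply_zero_zero hE hF _ (hA _ (hstab hg hE10))⟩
        have hx : x = 0 := by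
          by_contra hx
          apply hE01
          have hmem : (adZero (Fin 2) k).toRepresentation (r g) E10 - y • E10 ∈ W.toSubmodule :=
            W.toSubmodule.sub_mem (hstab hg hE10) (W.toSubmodule.smul_mem _ hE10)
          rw [hw', add_sub_cancel_right] at hmem
          exact (Submodule.smul_mem_iff _ hx).1 hmem
        rw [hx, zero_smul, zero_add] at hw'
        exact apply_zero_one_eq_zero_of_adGL_E10 hF hw'
      -- a non-zero `w = a E₀₁ + b E₁₀ ∈ W`
      obtain ⟨w, hwW, hw0⟩ := Submodule.exists_mem_ne_zero_of_ne_bot hWne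
      obtain ⟨a, b, rfl⟩ : ∃ a b : k, w = a • E01 + b • E10 :=
        ⟨_, _, eq_add_of_apply_zero_zero hE hF w (hA w hwW)⟩
      have hab0 : a ≠ 0 ∨ b ≠ 0 := by
        by_contra! h0
        apply hw0
        rw [h0.1, h0.2, zero_smul, zero_smul, add_zero]
      -- the action of `D = diag(α, β)`
      set α : k := (D : Matrix (Fin 2) (Fin 2) k) 0 0 with hα
      set β : k := (D : Matrix (Fin 2) (Fin 2) k) 1 1 with hβ
      have hDw : (adZero (Fin 2) k).toRepresentation D (a • E01 + b • E10) =
          (α * β⁻¹ * a) • E01 + (β * α⁻¹ * b) • E10 := by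
        rw [map_add, map_smul, map_smul, adGL_E01_of_isDg hE D hD, adGL_E10_of_isDg hF D hD, smul_smul,
          smul_smul, mul_comm a, mul_comm b]
      have hDwW : (adZero (Fin 2) k).toRepresentation D (a • E01 + b • E10) ∈ W.toSubmodule := hstab hDH hwW
      by_cases hsq : α * α = β * β
      · -- `β = -α`: `Ad(D)` is `-1` on `⟨E₀₁, E₁₀⟩`
        have hβα : β = -α := by
          have e : (α - β) * (α + β) = 0 := by linear_combination hsq
          rcases mul_eq_zero.1 e with e | e
          · exact absurd (sub_eq_zero.1 e) hab
          · linear_combination e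
        have hDw' : (adZero (Fin 2) k).toRepresentation D (a • E01 + b • E10) = -(a • E01 + b • E10) := by
          rw [hDw, hβα]
          have e1 : α * (-α)⁻¹ * a = -a := by rw [inv_neg]; field_simp
          have e2 : -α * α⁻¹ * b = -b := by field_simp
          rw [e1, e2]
          module
        by_cases ha0 : a = 0
        · subst ha0
          have hb0 : b ≠ 0 := hab0.resolve_left (fun h ↦ h rfl)
          have hE10 : E10 ∈ W.toSubmodule := by
            rw [zero_smul, zero_add] at hwW
            exact (Submodule.smul_mem_iff _ hb0).1 hwW
          exact (hlower hE10 fun hE01 ↦ hB1 ⟨hE01, hE10⟩).elim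
        by_cases hb0 : b = 0
        · subst hb0
          have hE01 : E01 ∈ W.toSubmodule := by
            rw [zero_smul, add_zero] at hwW
            exact (Submodule.smul_mem_iff _ ha0).1 hwW
          exact (hupper hE01 fun hE10 ↦ hB1 ⟨hE01, hE10⟩).elim
        -- `a, b ≠ 0`: `W` is the line through `w`, `det w ≠ 0`
        have hdet : ((a • E01 + b • E10 : (adZero (Fin 2) k).toSubmodule) : Matrix (Fin 2) (Fin 2) k).det ≠ 0 := by
          rw [coe_smul_E01_add_smul_E10 hE hF, Matrix.det_fin_two]
          simp [ha0, hb0]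
        have hline := exists_eq_smul_of_line hE hF W.toSubmodule hA hB1 hwW ha0
        -- if no regular semisimple element fixed a non-zero vector of `W`, `H` would be diagonal
        by_contra hcon
        push Not at hcon
        have hcent : ∀ z ∈ r.range, (adZero (Fin 2) k).toRepresentation z (a • E01 + b • E10) = a • E01 + b • E10 →
            z ∈ Subgroup.center (GL (Fin 2) k) := by
          intro z hz hzw
          by_contra hzc
          exact hcon ⟨z, hz⟩ (hrs hz hzc) _ hwW hw0 hzw
        refine hce (hasCommonEigenvector_of_forall_isDg fun g ↦ ?_)
        have hg : r g ∈ r.range := ⟨g, rfl⟩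
        obtain ⟨c, hc⟩ := hline _ (hstab hg hwW)
        rcases eq_one_or_eq_neg_one_of_adGL_eq_smul hc hdet with rfl | rfl
        · rw [one_smul] at hc
          exact GL2.isDg_of_mem_center (hcent _ hg hc)
        · have h2 : (adZero (Fin 2) k).toRepresentation (r g * D) (a • E01 + b • E10) = a • E01 + b • E10 := by
            rw [map_mul, Module.End.mul_apply, hDw', map_neg, hc]
            module
          have hzc := hcent _ (r.range.mul_mem hg hDH) h2
          have e : (r g : GL (Fin 2) k) = (r g * D) * D⁻¹ := by group
          rw [e, Units.val_mul, Matrix.coe_units_inv]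
          exact (GL2.isDg_of_mem_center hzc).mul hD.inv
      · -- `α² ≠ β²`: the eigenvalues `α/β ≠ β/α` of `Ad(D)` split `W`
        have hne : α * β⁻¹ - β * α⁻¹ ≠ 0 := by
          intro h0
          apply hsq
          have h1 : α * β⁻¹ = β * α⁻¹ := sub_eq_zero.1 h0
          field_simp at h1
          linear_combination h1
        rcases hab0 with ha0 | hb0
        · have hE01 : E01 ∈ W.toSubmodule := by
            have hmem : (adZero (Fin 2) k).toRepresentation D (a • E01 + b • E10) - (β * α⁻¹) • (a • E01 + b • E10) ∈
                W.toSubmodule := W.toSubmodule.sub_mem hDwW (W.toSubmodule.smul_mem _ hwW)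
            have e : (adZero (Fin 2) k).toRepresentation D (a • E01 + b • E10) - (β * α⁻¹) • (a • E01 + b • E10) =
                ((α * β⁻¹ - β * α⁻¹) * a) • E01 := by
              rw [hDw]; module
            rw [e] at hmem
            exact (Submodule.smul_mem_iff _ (mul_ne_zero hne ha0)).1 hmem
          exact (hupper hE01 fun hE10 ↦ hB1 ⟨hE01, hE10⟩).elim
        · have hE10 : E10 ∈ W.toSubmodule := by
            have hmem : (α * β⁻¹) • (a • E01 + b • E10) - (adZero (Fin 2) k).toRepresentation D (a • E01 + b • E10) ∈
                W.toSubmodule := W.toSubmodule.sub_mem (W.toSubmodule.smul_mem _ hwW) hDwW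
            have e : (α * β⁻¹) • (a • E01 + b • E10) - (adZero (Fin 2) k).toRepresentation D (a • E01 + b • E10) =
                ((α * β⁻¹ - β * α⁻¹) * b) • E10 := by
              rw [hDw]; module
            rw [e] at hmem
            exact (Submodule.smul_mem_iff _ (mul_ne_zero hne hb0)).1 hmem
          exact (hlower hE10 fun hE01 ↦ hB1 ⟨hE01, hE10⟩).elim

end Clause3

/-! ## §3. Enormousness -/
section Enormous

variable {k : Type u} [Field k] [IsAlgClosed k] {p : ℕ} [Fact p.Prime] [CharP k p]
variable {G : Type v} [Group G]


/-- **Enormous, in normal form.**  `r : G → GL₂(k)` (`k` algebraically closed, `char k = p ≠ 2`)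
with finite image `H` of order prime to `p`, without common eigenvector, and with some
`r(h₀) = diag(a, b)`, `a ≠ b`, has enormous image: (1) a quotient of order `p^n`, `n ≥ 1`, would
give `p ∣ |H|`; (2a) an `H`-invariant `M ∈ ad⁰` commutes with `diag(a, b)`, so `M = diag(m, -m)`,
and `m ≠ 0` would make every element of `H` diagonal; (2b) averaging over `H` (`|H| ∈ kˣ`, tree
`MonomialAdequacy.exists_eq_sub_of_subgroup`); (3) `exists_isRegularSemisimple_of_normalForm`.
[cite: ACCGHLNSTT2023, Def. 6.2.28] -/
theorem isEnormous_range_of_normalForm (hp2 : p ≠ 2) (r : G →* GL (Fin 2) k) [Finite r.range]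
    (hcard : ¬ p ∣ Nat.card r.range) (hce : ¬ HasCommonEigenvector r)
    {h₀ : G} (hD : GL2.IsDg ((r h₀ : GL (Fin 2) k) : Matrix (Fin 2) (Fin 2) k))
    (hab : ((r h₀ : GL (Fin 2) k) : Matrix (Fin 2) (Fin 2) k) 0 0 ≠ ((r h₀ : GL (Fin 2) k) : Matrix (Fin 2) (Fin 2) k) 1 1) :
    Subgroup.IsEnormous r.range := by
  classical
  have hp : p.Prime := Fact.out
  have htwo : (2 : k) ≠ 0 := fun h ↦ by
    have h' : ((2 : ℕ) : k) = 0 := by exact_mod_cast h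
    exact hp2 ((Nat.prime_dvd_prime_iff_eq hp Nat.prime_two).1 ((CharP.cast_eq_zero_iff k p _).1 h'))
  have hcast : ((Nat.card r.range : ℕ) : k) ≠ 0 := fun h ↦ hcard ((CharP.cast_eq_zero_iff k p _).1 h)
  refine ⟨fun N _ n hN ↦ ?_, ?_, ?_, fun W hW ↦ ?_⟩
  · -- (1) no non-trivial quotient of `p`-power order
    by_contra hn
    have h1 : p ∣ Nat.card (r.range ⧸ N) := by
      rw [hN, ringChar.eq k p]; exact dvd_pow_self p hn
    exact hcard (h1.trans (Subgroup.card_quotient_dvd_card N))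
  · -- (2a) `(ad⁰)^H = 0`
    exact invariants_eq_bot_of_normalForm htwo r hce hD hab
  · -- (2b) `H¹(H, ad⁰) = 0`: average over `H`
    rw [cocycles₁_le_coboundaries₁_iff_forall]
    intro f hf
    change ∀ g h : r.range, f (g * h) = Subgroup.adZeroRep r.range g (f h) + f g at hf
    change ∃ m, ∀ g : r.range, f g = Subgroup.adZeroRep r.range g m - m
    haveI : (⊥ : Subgroup r.range).FiniteIndex := inferInstance
    refine MonomialAdequacy.exists_eq_sub_of_subgroup _ ⊥ (by rwa [Subgroup.index_bot]) f hf
      ⟨0, fun x hx ↦ ?_⟩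
    rw [Subgroup.mem_bot] at hx
    rw [hx, map_one, map_zero, sub_zero]
    exact MonomialAdequacy.cocycle_apply_one _ f hf
  · -- (3)
    exact exists_isRegularSemisimple_of_normalForm hp2 r hcard hce hD hab W hW

/-- **An absolutely irreducible `r : G → GL₂(k)` with finite image of order prime to
`p = char k ≠ 2` has enormous image** (ACC+ Def. 6.2.28), for `k` algebraically closed whose
units have finite order prime to `p` (e.g. `k = 𝔽̄_p`) — uniformly for the dihedral, tetrahedral,
octahedral and icosahedral projective types.  Some `r(g₁)` is non-central (no common
eigenvector) and, having order prime to `p`, is conjugate to `diag(a, b)`, `a ≠ b`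
(`Serre1972.exists_conj_eq_diagonal_of_natCast_ne_zero`); the conjugate `P r P⁻¹` is enormous by
`isEnormous_range_of_normalForm`, and enormousness only depends on the image in `PGL₂(k)` up to
conjugation (tree `isEnormous_of_forall_exists_eq_scalar_mul_conj`).  This is the "image of
`r̄(G_{F(ζ_l)})` is enormous" input of Qian 2023, Thm. 1.4 whenever `l ∤ |image|`.
[cite: ACCGHLNSTT2023, Def. 6.2.28] -/
theorem isEnormous_range_of_not_dvd_card (hp2 : p ≠ 2)
    (htor : ∀ a : kˣ, ∃ m : ℕ, ¬ p ∣ m ∧ a ^ m = 1)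
    (r : G →* GL (Fin 2) k) [Finite r.range] (hcard : ¬ p ∣ Nat.card r.range)
    (hirr : IsAbsIrreducible r) : Subgroup.IsEnormous r.range := by
  have hce : ¬ HasCommonEigenvector r := by
    refine not_hasCommonEigenvector_of_isIrreducible r ?_
    have h1 := hirr k (RingHom.id k)
    have e : (Matrix.GeneralLinearGroup.map (RingHom.id k)).comp r = r := by ext g i j; simp
    rwa [e] at h1
  have hcast : ((Nat.card r.range : ℕ) : k) ≠ 0 := fun h ↦ hcard ((CharP.cast_eq_zero_iff k p _).1 h)
  -- a non-central element, diagonalised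
  obtain ⟨g₁, hg₁⟩ : ∃ g₁, r g₁ ∉ Subgroup.center (GL (Fin 2) k) := by
    by_contra! hall
    exact hce (hasCommonEigenvector_of_forall_isDg fun g ↦ GL2.isDg_of_mem_center (hall g))
  have hpow : r g₁ ^ Nat.card r.range = 1 := by
    have h := pow_card_eq_one' (G := r.range) (x := ⟨r g₁, g₁, rfl⟩)
    have h' := congrArg Subtype.val h
    simpa only [Subgroup.coe_pow, Subgroup.coe_one] using h'
  obtain ⟨Q, d, hd, hQ⟩ :=
    Serre1972.exists_conj_eq_diagonal_of_natCast_ne_zero (r g₁) hcast hpow hg₁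
  set r' := conjGL Q⁻¹ r with hr'
  have hr'g₁ : ((r' g₁ : GL (Fin 2) k) : Matrix (Fin 2) (Fin 2) k) = diagonal d := by
    rw [hr', conjGL_apply, inv_inv]; exact hQ
  have hD : GL2.IsDg ((r' g₁ : GL (Fin 2) k) : Matrix (Fin 2) (Fin 2) k) := by rw [hr'g₁]; exact GL2.isDg_diagonal d
  have hab : ((r' g₁ : GL (Fin 2) k) : Matrix (Fin 2) (Fin 2) k) 0 0 ≠ ((r' g₁ : GL (Fin 2) k) : Matrix (Fin 2) (Fin 2) k) 1 1 := by
    rw [hr'g₁]; simpa using hd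
  have hce' : ¬ HasCommonEigenvector r' := fun h ↦ hce (HasCommonEigenvector.of_conjGL h)
  -- `r'(G) = Q⁻¹ r(G) Q` is finite of the same order
  have hrange : r'.range = r.range.map (MulAut.conj Q⁻¹).toMonoidHom := MonoidHom.range_comp _ _
  haveI : Finite r'.range := by
    rw [hrange]
    exact Finite.of_equiv _ (r.range.equivMapOfInjective _ (MulAut.conj Q⁻¹).injective).toEquiv
  have hcard' : ¬ p ∣ Nat.card r'.range := by
    rwa [hrange, Subgroup.card_map_of_injective (MulAut.conj Q⁻¹).injective]
  have hen' : Subgroup.IsEnormous r'.range := isEnormous_range_of_normalForm hp2 r' hcard' hce' hD hab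
  refine isEnormous_of_forall_exists_eq_scalar_mul_conj htor Q⁻¹⁻¹ (H' := r'.range) ?_ ?_ hen'
  · rintro _ ⟨g, rfl⟩
    refine ⟨r' g, ⟨g, rfl⟩, 1, ?_⟩
    rw [map_one, one_mul, hr', conjGL_apply, inv_inv]
    group
  · rintro _ ⟨g, rfl⟩
    refine ⟨r g, ⟨g, rfl⟩, 1, ?_⟩
    rw [map_one, one_mul, conjGL_apply, inv_inv]
    group

end Enormous

end Summit.Langlands.Langlands.Cruxes.LocallyReducibleParallel.Potaut

end
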